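import Literature.Computability.Complexity.RandomizingPolynomialsCanon
import Literature.Computability.Complexity.RandomizingPolynomialsBlock
import Mathlib.Data.List.GetD
import HarnessLib

/-!
# Randomizing polynomials IV: the block of a monomial is a perfect extension

`PerfExt n n' O f` packages, for a block `O` of sparse output polynomials with fresh variables in
`[n, n')`, the three properties of a PERFECT randomized encoding of the target `f` in the language of
valuations `v : ℕ → ZMod 2` [Applebaum–Ishai–Kushilevitz 2006, Def. 4.1 (perfect randomized
encoding: perfectly correct, perfectly private, balanced, stretch-preserving)]:

* `inj`  — valuations that agree below `n` and give the same outputs agree below `n'`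
  (the randomness is recoverable: no entropy of the fresh variables is lost);
* `dec`  — the outputs determine the target (perfect correctness);
* `range` — valuations with the same target have the same SET of outputs over all choices of the
  variables from `n` on (perfect privacy + balance, in counting form).

Main result: `perfExt_ikBlock` — the degree-3 block `ikBlock n₀ T ρ` of file III is a perfect
extension of `v ↦ ∏_{t ∈ T} v t + ∑_{r ∈ ρ} v r` with fresh variables `[n₀, n₀ + pos d d)`,
`d = |T| - 1`, from the three matrix facts of file II.

## References

* B. Applebaum, Y. Ishai, E. Kushilevitz, *Cryptography in NC⁰*, SIAM J. Comput. 36 (2006), §4.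
* Y. Ishai, E. Kushilevitz, ICALP 2002, §3.
-/

namespace Literature.Computability.Complexity

namespace RandPoly

open Matrix Finset

/-! ### Perfect extensions -/

/-- Two valuations agree on the variables below `n`. [folklore] -/
def AgreeBelow (n : ℕ) (v w : ℕ → ZMod 2) : Prop := ∀ i, i < n → v i = w i

/-- **Perfect extension** of a target `f` (a function of the valuation, depending only on variables
below `n`) by a block `O` of output polynomials whose fresh variables lie in `[n, n')`: injectivity
on the fresh variables, decodability of the target, and outputs ranging over a set that depends
only on the target.  The valuation-level form of a perfect randomized encoding.
[cite: ApplebaumIshaiKushilevitz2006, Def. 4.1] -/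
structure PerfExt {β : Type} (n n' : ℕ) (O : List (List (List ℕ))) (f : (ℕ → ZMod 2) → β) : Prop where
  /-- Same prefix and same outputs force the same fresh variables. -/
  inj : ∀ v w, AgreeBelow n v w → evalM v O = evalM w O → AgreeBelow n' v w
  /-- The outputs determine the target. -/
  dec : ∀ v w, evalM v O = evalM w O → f v = f w
  /-- The set of outputs over a fixed prefix depends only on the target. -/
  range : ∀ v w, f v = f w → ∃ u, AgreeBelow n u w ∧ evalM u O = evalM v O

/-- `AgreeBelow` is reflexive. [folklore] -/
theorem AgreeBelow.refl {n : ℕ} (v : ℕ → ZMod 2) : AgreeBelow n v v := fun _ _ => Eq.refl _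

/-- `AgreeBelow` is symmetric. [folklore] -/
theorem AgreeBelow.symm {n : ℕ} {v w : ℕ → ZMod 2} (h : AgreeBelow n v w) : AgreeBelow n w v :=
  fun i hi => (h i hi).symm

/-- `AgreeBelow` is transitive. [folklore] -/
theorem AgreeBelow.trans {n : ℕ} {u v w : ℕ → ZMod 2} (h₁ : AgreeBelow n u v) (h₂ : AgreeBelow n v w) :
    AgreeBelow n u w := fun i hi => (h₁ i hi).trans (h₂ i hi)

/-- `AgreeBelow` is antitone in the bound. [folklore] -/
theorem AgreeBelow.mono {m n : ℕ} (hmn : m ≤ n) {v w : ℕ → ZMod 2} (h : AgreeBelow n v w) :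
    AgreeBelow m v w := fun i hi => h i (lt_of_lt_of_le hi hmn)

/-! ### Degree and support of the block -/

/-- Monomials of a product are concatenations. [folklore] -/
theorem mem_mulP {p q : List (List ℕ)} {μ : List ℕ} (h : μ ∈ mulP p q) :
    ∃ μ₁ ∈ p, ∃ μ₂ ∈ q, μ = μ₁ ++ μ₂ := by
  simp only [mulP, List.mem_flatMap, List.mem_map] at h
  obtain ⟨μ₁, h₁, μ₂, h₂, rfl⟩ := h
  exact ⟨μ₁, h₁, μ₂, h₂, rfl⟩

/-- Monomials of a symbolic `R₁` entry: at most one variable, a fresh one. [folklore] -/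
theorem mem_symR1 {n₀ i j : ℕ} {μ : List ℕ} (h : μ ∈ symR1 n₀ i j) :
    μ.length ≤ 1 ∧ ∀ x ∈ μ, x = n₀ + pos i j ∧ i < j := by
  unfold symR1 at h
  split_ifs at h with h1 h2 <;> simp_all

/-- Monomials of a symbolic path-matrix entry: at most one variable, from `T` or `ρ`. [folklore] -/
theorem mem_symL {T ρ : List ℕ} {d j l : ℕ} (hj : j < T.length) {μ : List ℕ} (h : μ ∈ symL T ρ d j l) :
    μ.length ≤ 1 ∧ ∀ x ∈ μ, x ∈ T ∨ x ∈ ρ := by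
  unfold symL at h
  simp only [List.mem_append, List.mem_ite_nil_right, List.mem_singleton, List.mem_map] at h
  rcases h with (⟨-, rfl⟩ | ⟨-, rfl⟩) | ⟨-, r, hr, rfl⟩
  · refine ⟨by simp, fun x hx => ?_⟩
    simp only [List.mem_singleton] at hx
    subst hx
    rw [List.getD_eq_getElem _ _ hj]
    exact Or.inl (List.getElem_mem hj)
  · simp
  · simpa using Or.inr hr

/-- Monomials of a symbolic `R₂` entry: at most one variable, a fresh one. [folklore] -/
theorem mem_symR2 {n₀ d l k : ℕ} {μ : List ℕ} (h : μ ∈ symR2 n₀ d l k) :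
    μ.length ≤ 1 ∧ ∀ x ∈ μ, x = n₀ + pos l l ∧ l < d := by
  unfold symR2 at h
  simp only [List.mem_append, List.mem_ite_nil_right, List.mem_singleton] at h
  rcases h with ⟨-, rfl⟩ | ⟨⟨-, hl⟩, rfl⟩ <;> simp_all

/-- **Every monomial of an entry has length `≤ 3`** and its variables are variables of `T`, of `ρ`,
`0`, or fresh variables `n₀ + pos a b` with `a ≤ b ≤ d`, `(a, b) ≠ (d, d)`. [cite: IshaiKushilevitz2002, §3] -/
theorem mem_entry {n₀ : ℕ} {T ρ : List ℕ} {d i k : ℕ} (hT : T.length = d + 1) {μ : List ℕ}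
    (h : μ ∈ entry n₀ T ρ d i k) :
    μ.length ≤ 3 ∧ ∀ x ∈ μ, x ∈ T ∨ x ∈ ρ ∨
      ∃ a b, a ≤ b ∧ b ≤ d ∧ (a < b ∨ b < d) ∧ x = n₀ + pos a b := by
  simp only [entry, List.mem_flatMap, List.mem_range] at h
  obtain ⟨j, hj, l, hl, hμ⟩ := h
  obtain ⟨μ₁₂, h₁₂, μ₃, h₃, rfl⟩ := mem_mulP hμ
  obtain ⟨μ₁, h₁, μ₂, h₂, rfl⟩ := mem_mulP h₁₂
  obtain ⟨hl₁, hx₁⟩ := mem_symR1 h₁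
  obtain ⟨hl₂, hx₂⟩ := mem_symL (by omega) h₂
  obtain ⟨hl₃, hx₃⟩ := mem_symR2 h₃
  refine ⟨by simp only [List.length_append]; omega, fun x hx => ?_⟩
  simp only [List.mem_append] at hx
  rcases hx with (hx | hx) | hx
  · obtain ⟨rfl, hij⟩ := hx₁ x hx
    exact Or.inr (Or.inr ⟨i, j, le_of_lt hij, by omega, Or.inl hij, rfl⟩)
  · rcases hx₂ x hx with h | h
    · exact Or.inl h
    · exact Or.inr (Or.inl h)
  · obtain ⟨rfl, hld⟩ := hx₃ x hx
    exact Or.inr (Or.inr ⟨l, l, le_rfl, by omega, Or.inr hld, rfl⟩)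

/-- Fresh variables of a block are below `pos d d`. [folklore] -/
theorem pos_lt_pos_self {a b d : ℕ} (hab : a ≤ b) (hbd : b ≤ d) (h : a < b ∨ b < d) : pos a b < pos d d := by
  rcases h with h | h
  · rcases Nat.lt_or_ge b d with hb | hb
    · calc pos a b < tri (b + 1) := by simp [pos, tri]; omega
        _ ≤ tri d := tri_mono hb
        _ ≤ pos d d := Nat.le_add_right _ _
    · have : b = d := le_antisymm hbd hb
      subst this; simp [pos]; omega
  · calc pos a b < tri (b + 1) := by simp [pos, tri]; omega
      _ ≤ tri d := tri_mono h
      _ ≤ pos d d := Nat.le_add_right _ _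

/-- **Degree and support of the block**: every monomial has length `≤ 3` and its variables are
variables of `T`, of `ρ`, or fresh variables in `[n₀, n₀ + pos d d)`, `d = |T| - 1`.
[cite: IshaiKushilevitz2002, §3] -/
theorem mem_ikBlock {n₀ : ℕ} {T ρ : List ℕ} (hT : T ≠ []) {q : List (List ℕ)} (hq : q ∈ ikBlock n₀ T ρ)
    {μ : List ℕ} (hμ : μ ∈ q) :
    μ.length ≤ 3 ∧ ∀ x ∈ μ, x ∈ T ∨ x ∈ ρ ∨ (n₀ ≤ x ∧ x < n₀ + pos (T.length - 1) (T.length - 1)) := by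
  simp only [ikBlock, List.mem_map] at hq
  obtain ⟨⟨i, k⟩, hik, rfl⟩ := hq
  have hTl : T.length = (T.length - 1) + 1 := by
    have := List.length_pos_of_ne_nil hT; omega
  obtain ⟨hlen, hx⟩ := mem_entry hTl hμ
  refine ⟨hlen, fun x hxμ => ?_⟩
  rcases hx x hxμ with h | h | ⟨a, b, hab, hbd, hor, rfl⟩
  · exact Or.inl h
  · exact Or.inr (Or.inl h)
  · exact Or.inr (Or.inr ⟨Nat.le_add_right _ _, by have := pos_lt_pos_self hab hbd hor; omega⟩)


/-! ### The block of a monomial -/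

variable {d : ℕ}

/-- The variables of `T` read the same values under valuations agreeing below a bound on `T`.
[folklore] -/
theorem xsOf_congr {n₀ : ℕ} {T : List ℕ} (hT : ∀ t ∈ T, t < n₀) (hTl : T.length = d + 1)
    {v w : ℕ → ZMod 2} (h : AgreeBelow n₀ v w) : xsOf d T v = xsOf d T w := by
  funext j
  simp only [xsOf]
  have hj : j.val < T.length := by rw [hTl]; exact j.isLt
  rw [List.getD_eq_getElem _ _ hj]
  exact h _ (hT _ (List.getElem_mem hj))

/-- The affine part reads the same value under valuations agreeing below a bound on `ρ`. [folklore] -/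
theorem rhoOf_congr {n₀ : ℕ} {ρ : List ℕ} (hρ : ∀ r ∈ ρ, r < n₀) {v w : ℕ → ZMod 2}
    (h : AgreeBelow n₀ v w) : rhoOf ρ v = rhoOf ρ w := by
  unfold rhoOf
  rw [List.map_congr_left fun r hr => h r (hρ r hr)]

/-- The value of the path is the value of the monomial plus the affine part. [folklore] -/
theorem pathVal_xsOf (T : List ℕ) (hTl : T.length = d + 1) (ρ : List ℕ) (v : ℕ → ZMod 2) :
    pathVal (xsOf d T v) (rhoOf ρ v) = (T.map v).prod + rhoOf ρ v := by
  unfold pathVal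
  congr 1
  induction d generalizing T with
  | zero =>
    match T, hTl with
    | [t], _ => simp [xsOf]
  | succ d ih =>
    match T, hTl with
    | t :: T', hl =>
      rw [Fin.prod_univ_succ, List.map_cons, List.prod_cons]
      have hl' : T'.length = d + 1 := by simpa using hl
      rw [← ih T' hl']
      rfl

/-- Entries of `R₁(v)` above the diagonal are the fresh variables. [folklore] -/
theorem matR1_apply_of_lt (n₀ : ℕ) (v : ℕ → ZMod 2) {i j : Fin (d + 1)} (hij : i < j) :
    matR1 n₀ d v i j = v (n₀ + pos i.val j.val) := by
  simp [matR1, ne_of_lt hij, hij]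

/-- Entries of `R₂(v)` in the last column above the diagonal are the fresh variables. [folklore] -/
theorem matR2_apply_last (n₀ : ℕ) (v : ℕ → ZMod 2) {l : Fin (d + 1)} (hl : l ≠ Fin.last d) :
    matR2 n₀ d v l (Fin.last d) = v (n₀ + pos l.val l.val) := by
  simp [matR2, hl]

/-- `find?` on `pairsLE` locates a pair by its position. [folklore] -/
theorem find?_pairsLE_pos (n₀ : ℕ) {i k : ℕ} (hik : i ≤ k) (hkd : k ≤ d) :
    (pairsLE d).find? (fun ab => n₀ + pos ab.1 ab.2 = n₀ + pos i k) = some (i, k) := by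
  cases h : (pairsLE d).find? (fun ab => n₀ + pos ab.1 ab.2 = n₀ + pos i k) with
  | none =>
    rw [List.find?_eq_none] at h
    exact absurd (by simp) (h (i, k) (mem_pairsLE.2 ⟨hik, hkd⟩))
  | some ab =>
    have h1 := List.find?_some h
    have h2 := mem_pairsLE.1 (List.mem_of_find?_eq_some h)
    simp only [decide_eq_true_eq] at h1
    obtain ⟨ha, hb⟩ := pos_inj h2.1 hik (by omega)
    rw [← ha, ← hb]

/-- **The degree-3 block of a monomial is a perfect extension of `monomial + affine part`.** For
`|T| = d + 1`, all variables of `T` and `ρ` below `n₀`: fresh variables `[n₀, n₀ + pos d d)`.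
[cite: IshaiKushilevitz2002, §3] -/
theorem perfExt_ikBlock (n₀ : ℕ) {T : List ℕ} (hTl : T.length = d + 1) (hT : ∀ t ∈ T, t < n₀)
    {ρ : List ℕ} (hρ : ∀ r ∈ ρ, r < n₀) :
    PerfExt n₀ (n₀ + pos d d) (ikBlock n₀ T ρ) (fun v => (T.map v).prod + rhoOf ρ v) := by
  refine ⟨fun v w hvw he => ?_, fun v w he => ?_, fun v w hf => ?_⟩
  · -- injectivity on the fresh block
    rw [evalM_ikBlock_eq_iff n₀ hTl, xsOf_congr hT hTl hvw, rhoOf_congr hρ hvw] at he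
    obtain ⟨hA, hB⟩ := eq_of_proj_pathMat_eq (matR1_isUnitri n₀ d v) (matR1_isUnitri n₀ d w)
      (matR2_isLastCol n₀ d v) (matR2_isLastCol n₀ d w) he
    intro m hm
    by_cases hmn : m < n₀
    · exact hvw m hmn
    obtain ⟨i, k, hik, hkd, hor, hpos⟩ := exists_pos_eq (m := m - n₀) (d := d) (by omega)
    have hm' : m = n₀ + pos i k := by omega
    rw [hm']
    have hk1 : k < d + 1 := by omega
    by_cases hlt : i < k
    · have h1 := congrFun (congrFun hA ⟨i, by omega⟩) ⟨k, hk1⟩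
      rwa [matR1_apply_of_lt n₀ v (Fin.mk_lt_mk.2 hlt), matR1_apply_of_lt n₀ w (Fin.mk_lt_mk.2 hlt)]
        at h1
    · have hik' : i = k := by omega
      subst hik'
      have hkd' : i < d := by omega
      have hne : (⟨i, hk1⟩ : Fin (d + 1)) ≠ Fin.last d := fun h' => by
        have := congrArg Fin.val h'; simp at this; omega
      have h1 := congrFun (congrFun hB ⟨i, hk1⟩) (Fin.last d)
      rwa [matR2_apply_last n₀ v hne, matR2_apply_last n₀ w hne] at h1
  · -- decodability
    rw [evalM_ikBlock_eq_iff n₀ hTl] at he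
    have := pathVal_eq_of_proj_eq (matR1_isUnitri n₀ d v) (matR1_isUnitri n₀ d w)
      (matR2_isLastCol n₀ d v) (matR2_isLastCol n₀ d w) he
    rwa [pathVal_xsOf T hTl, pathVal_xsOf T hTl] at this
  · -- range
    replace hf : (T.map v).prod + rhoOf ρ v = (T.map w).prod + rhoOf ρ w := hf
    rw [← pathVal_xsOf T hTl, ← pathVal_xsOf T hTl] at hf
    obtain ⟨A', B', hA', hB', heq⟩ :=
      exists_proj_pathMat_eq hf (matR1_isUnitri n₀ d v) (matR2_isLastCol n₀ d v)
    -- the valuation realising `(A', B')` over the prefix of `w`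
    let u : ℕ → ZMod 2 := fun m =>
      if m < n₀ then w m else
        match (pairsLE d).find? (fun ab => n₀ + pos ab.1 ab.2 = m) with
        | some ab =>
          if h : ab.1 < ab.2 ∧ ab.2 < d + 1 then A' ⟨ab.1, by omega⟩ ⟨ab.2, h.2⟩
          else if h : ab.1 = ab.2 ∧ ab.2 < d then B' ⟨ab.1, by omega⟩ (Fin.last d)
          else w m
        | none => w m
    have huw : AgreeBelow n₀ u w := fun m hm => by simp [u, hm]
    have hAu : matR1 n₀ d u = A' := by
      ext i j
      rcases lt_trichotomy i j with hij | rfl | hji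
      · rw [matR1_apply_of_lt n₀ u hij]
        have hfind := find?_pairsLE_pos (d := d) n₀ (le_of_lt (Fin.lt_def.1 hij))
          (Nat.le_of_lt_succ j.isLt)
        simp only [u, if_neg (by omega : ¬ (n₀ + pos i.val j.val < n₀)), hfind]
        rw [dif_pos ⟨Fin.lt_def.1 hij, j.isLt⟩]
      · rw [(matR1_isUnitri n₀ d u).1, hA'.1]
      · rw [(matR1_isUnitri n₀ d u).2 i j hji, hA'.2 i j hji]
    have hBu : matR2 n₀ d u = B' := by
      ext l k
      by_cases hk : k = Fin.last d
      · subst hk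
        by_cases hl : l = Fin.last d
        · rw [hl, (matR2_isLastCol n₀ d u).1, hB'.1]
        · rw [matR2_apply_last n₀ u hl]
          have hld : l.val < d := Fin.val_lt_last hl
          have hfind := find?_pairsLE_pos (d := d) n₀ (le_refl l.val) (le_of_lt hld)
          simp only [u, if_neg (by omega : ¬ (n₀ + pos l.val l.val < n₀)), hfind]
          split_ifs with h1 h2
          · exact absurd h1.1 (lt_irrefl _)
          · rfl
          · exact absurd ⟨trivial, hld⟩ h2
      · by_cases hlk : l = k
        · subst hlk; rw [(matR2_isLastCol n₀ d u).1, hB'.1]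
        · rw [(matR2_isLastCol n₀ d u).2 l k hlk hk, hB'.2 l k hlk hk]
    refine ⟨u, huw, ?_⟩
    rw [evalM_ikBlock_eq_iff n₀ hTl, hAu, hBu, xsOf_congr hT hTl huw, rhoOf_congr hρ huw, heq]
    exact fun _ _ _ => rfl

end RandPoly

end Literature.Computability.Complexity
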